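import Mathlib
import Literature.MathematicalPhysics.QuantumFieldTheory.WilsonTorusTimeSlicing
import HarnessLib

/-!
# Time slicing of Wilson's lattice gauge theory on a tube `ℤ_T × S`: assembling a configuration from slices and layers

Companion of `WilsonTorusTimeSlicing.lean` (periodic four-torus) for a TUBE `ℤ_T × S` over an arbitrary finite spatial
slice `S` (for the free tube of the route `ContractibleFibre` of `QuantumFields/YangMills`, `S = ZMod L × Fin (M+1)²` with
free fibre faces): sites `ZMod T × S`, links `(ZMod T × S) × Fin 4 → G` (direction `0` = time), three spatial directions
with spatial shifts `shS : S → Fin 3 → S`, plaquette weights `ins` (e.g. the indicator killing the plaquettes that leave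
a free face).  All objects are VARIABLES with their defining equations / structural hypotheses (the tube shift `sh` —
`sh (t, s) 0 = (t + 1, s)`, `sh (t, s) (j+1) = (t, shS s j)` —, the weights `ins (t, s) = insS s`, the plaquettes `pl` and
the action `act = β Σ_x Σ_{μ<κ} ins · Re tr ρ(U_P)`, literally the inline `let`s of
`Summit.QuantumFields.YangMills.Theses.ContractibleFibre.FibreAnchor`; `asm` assembles a configuration from its
spatial slices `V t : S × Fin 3 → G` and temporal layers `E t : S → G`; `Ssp`, `Stm` are the spatial plaquette energy of
a slice and the temporal plaquette energy between consecutive slices), so that no definition is introduced.  PROVED: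

* `measurePreserving_asm` — assembling pushes the product of the slice and layer Haar products forward to the product
  Haar measure of the tube; `integral_comp_asm`;
* `act_asm` — the action splits over slabs, `act (asm (V, E)) = Σ_t [Ssp (V t) + Stm (V t) (E t) (V (t+1))]`;
* `apply_asm_eq_of_eqOn`, `shift_asm` — slab locality and time shifts read through the assembling map;
* `continuous_act`, `continuous_Ssp`, `continuous_Stm` and the resulting bounds (compactness).

References: K. Osterwalder, E. Seiler, Ann. Phys. 110 (1978) 440, §2; I. Montvay, G. Münster, *Quantum Fields on a
Lattice* (1994) §3.2.6.
-/

set_option autoImplicit false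

noncomputable section

open scoped BigOperators
open MeasureTheory Filter Function
open Literature.MathematicalPhysics.QuantumFieldTheory

namespace Literature.MathematicalPhysics.QuantumFieldTheory.FreeTube

/-! ### Index bookkeeping -/

section Index

/-- A vector of pairs with a common first component. [folklore] -/
theorem vec3_pair {α β : Type*} (t : α) (a b c : β) (j : Fin 3) :
    (![(t, a), (t, b), (t, c)] : Fin 3 → α × β) j = (t, (![a, b, c] : Fin 3 → β) j) := by
  fin_cases j <;> rfl

/-- A sum over the ordered pairs of `Fin 4` as a double sum with an indicator. [folklore] -/
theorem sum_subtype_lt_eq {M : Type*} [AddCommMonoid M] (f : Fin 4 → Fin 4 → M) :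
    ∑ q : {q : Fin 4 × Fin 4 // q.1 < q.2}, f q.1.1 q.1.2 = ∑ a : Fin 4, ∑ b : Fin 4, if a < b then f a b else 0 := by
  rw [← Finset.sum_subtype (p := fun pr : Fin 4 × Fin 4 => pr.1 < pr.2)
      (Finset.univ.filter fun pr : Fin 4 × Fin 4 => pr.1 < pr.2) (fun _ => by simp)
      (fun pr : Fin 4 × Fin 4 => f pr.1 pr.2),
    Finset.sum_filter, Fintype.sum_prod_type]

/-- Regrouping a product over the links of the tube by time, spatial (`i.succ`) versus temporal (`0`) direction.
[folklore] -/
theorem prod_link_eq {α S : Type*} [Fintype α] [Fintype S] {M : Type*} [CommMonoid M] (f : (α × S) × Fin 4 → M) :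
    ∏ e, f e = (∏ t : α, ∏ q : S × Fin 3, f ((t, q.1), q.2.succ)) * ∏ t : α, ∏ s : S, f ((t, s), 0) := by
  rw [Fintype.prod_prod_type, Fintype.prod_prod_type]
  simp only [Fintype.prod_prod_type (f := fun q : S × Fin 3 => f ((_, q.1), q.2.succ))]
  rw [← Finset.prod_mul_distrib]
  refine Finset.prod_congr rfl fun t _ => ?_
  rw [← Finset.prod_mul_distrib]
  refine Finset.prod_congr rfl fun s _ => ?_
  rw [Fin.prod_univ_succ, mul_comm]

end Index

/-! ### The assembling map -/

section Assemble

variable {G : Type*} {T : ℕ} {S : Type*}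

variable (asm : (ZMod T → S × Fin 3 → G) × (ZMod T → S → G) → (ZMod T × S) × Fin 4 → G)
  (hasm : ∀ p e, asm p e = (Fin.cons (p.2 e.1.1 e.1.2) (fun i : Fin 3 => p.1 e.1.1 (e.1.2, i)) : Fin 4 → G) e.2)

include hasm

/-- The temporal links of an assembled configuration. [folklore] -/
theorem asm_apply_zero (p : (ZMod T → S × Fin 3 → G) × (ZMod T → S → G)) (x : ZMod T × S) :
    asm p (x, 0) = p.2 x.1 x.2 := by
  rw [hasm]; rfl

/-- The spatial links of an assembled configuration. [folklore] -/
theorem asm_apply_succ (p : (ZMod T → S × Fin 3 → G) × (ZMod T → S → G)) (x : ZMod T × S) (i : Fin 3) :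
    asm p (x, i.succ) = p.1 x.1 (x.2, i) := by
  rw [hasm]; exact Fin.cons_succ _ _ _

/-- Assembling is measurable. [folklore] -/
theorem measurable_asm [MeasurableSpace G] : Measurable asm := by
  refine measurable_pi_lambda _ fun e => ?_
  obtain ⟨x, μ⟩ := e
  refine Fin.cases ?_ (fun i => ?_) μ
  · simp only [asm_apply_zero asm hasm]
    exact (measurable_pi_apply _).comp ((measurable_pi_apply _).comp measurable_snd)
  · simp only [asm_apply_succ asm hasm]
    exact (measurable_pi_apply _).comp ((measurable_pi_apply _).comp measurable_fst)

/-- The preimage of a box of link sets under assembling is a product of boxes of slices and layers. [folklore] -/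
theorem preimage_asm_pi (s : (ZMod T × S) × Fin 4 → Set G) :
    asm ⁻¹' Set.pi Set.univ s =
      (Set.pi Set.univ fun t : ZMod T => Set.pi Set.univ fun q : S × Fin 3 => s ((t, q.1), q.2.succ)) ×ˢ
        (Set.pi Set.univ fun t : ZMod T => Set.pi Set.univ fun y : S => s ((t, y), 0)) := by
  ext p
  simp only [Set.mem_preimage, Set.mem_pi, Set.mem_univ, true_implies, Set.mem_prod]
  constructor
  · intro h
    refine ⟨fun t q => ?_, fun t y => ?_⟩
    · simpa only [asm_apply_succ asm hasm] using h ((t, q.1), q.2.succ)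
    · simpa only [asm_apply_zero asm hasm] using h ((t, y), 0)
  · rintro ⟨h1, h2⟩ ⟨x, μ⟩
    refine Fin.cases ?_ (fun i => ?_) μ
    · simpa only [asm_apply_zero asm hasm] using h2 x.1 x.2
    · simpa only [asm_apply_succ asm hasm] using h1 x.1 (x.2, i)

variable [Group G] [TopologicalSpace G] [IsTopologicalGroup G] [CompactSpace G] [MeasurableSpace G] [BorelSpace G]

/-- **Assembling is measure preserving** from the product of the slice and layer Haar products to the product Haar
measure of the tube (`Measure.pi_eq` on boxes, `prod_link_eq`). [folklore] -/
theorem measurePreserving_asm [NeZero T] [Fintype S] :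
    MeasurePreserving asm
      ((Measure.pi fun _ : ZMod T => Measure.pi fun _ : S × Fin 3 => haarProbability G).prod
        (Measure.pi fun _ : ZMod T => Measure.pi fun _ : S => haarProbability G))
      (Measure.pi fun _ : (ZMod T × S) × Fin 4 => haarProbability G) := by
  refine ⟨measurable_asm asm hasm, ?_⟩
  symm
  refine Measure.pi_eq fun s hs => ?_
  rw [Measure.map_apply (measurable_asm asm hasm) (MeasurableSet.univ_pi hs), preimage_asm_pi asm hasm,
    Measure.prod_prod, Measure.pi_pi, Measure.pi_pi, prod_link_eq]
  simp only [Measure.pi_pi]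

omit [TopologicalSpace G] [IsTopologicalGroup G] [CompactSpace G] [BorelSpace G] in
/-- **Integrals over the tube pulled back to slices and layers.** [folklore] -/
theorem integral_comp_asm [NeZero T] [Fintype S] [TopologicalSpace G] [IsTopologicalGroup G] [CompactSpace G]
    [BorelSpace G] (Φ : ((ZMod T × S) × Fin 4 → G) → ℝ) (hΦ : Measurable Φ) :
    ∫ U, Φ U ∂(Measure.pi fun _ : (ZMod T × S) × Fin 4 => haarProbability G) =
      ∫ p, Φ (asm p) ∂((Measure.pi fun _ : ZMod T => Measure.pi fun _ : S × Fin 3 => haarProbability G).prod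
        (Measure.pi fun _ : ZMod T => Measure.pi fun _ : S => haarProbability G)) := by
  have hmp := measurePreserving_asm asm hasm
  rw [← hmp.map_eq, integral_map (measurable_asm asm hasm).aemeasurable]
  rw [hmp.map_eq]
  exact hΦ.aestronglyMeasurable

omit [TopologicalSpace G] [IsTopologicalGroup G] [CompactSpace G] [MeasurableSpace G] [BorelSpace G] [Group G] in
/-- **Slab locality read through the assembling map**: a tube functional depending on the links based in the time
slab `A` only depends, after assembling, on the slices and layers `V t`, `E t`, `t ∈ A` only. [folklore] -/
theorem apply_asm_eq_of_eqOn {R : Type*} (F : ((ZMod T × S) × Fin 4 → G) → R) (A : Set (ZMod T))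
    (hF : ∀ U U', (∀ p : (ZMod T × S) × Fin 4, p.1.1 ∈ A → U p = U' p) → F U = F U')
    (V V' : ZMod T → S × Fin 3 → G) (E E' : ZMod T → S → G)
    (hV : ∀ t ∈ A, V t = V' t) (hE : ∀ t ∈ A, E t = E' t) : F (asm (V, E)) = F (asm (V', E')) := by
  refine hF _ _ fun p hp => ?_
  obtain ⟨x, μ⟩ := p
  refine Fin.cases ?_ (fun i => ?_) μ
  · rw [asm_apply_zero asm hasm, asm_apply_zero asm hasm]
    exact congrFun (hE x.1 hp) x.2
  · rw [asm_apply_succ asm hasm, asm_apply_succ asm hasm]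
    exact congrFun (hV x.1 hp) (x.2, i)

omit [TopologicalSpace G] [IsTopologicalGroup G] [CompactSpace G] [MeasurableSpace G] [BorelSpace G] [Group G] in
/-- **Time shifts read through the assembling map**: shifting the tube configuration by `n` in time is assembling the
shifted slices and layers. [folklore] -/
theorem shift_asm (σ : ℕ → ((ZMod T × S) × Fin 4 → G) → (ZMod T × S) × Fin 4 → G)
    (hσ : ∀ n U p, σ n U p = U ((p.1.1 + n, p.1.2), p.2)) (n : ℕ)
    (V : ZMod T → S × Fin 3 → G) (E : ZMod T → S → G) :
    σ n (asm (V, E)) = asm (fun t => V (t + n), fun t => E (t + n)) := by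
  funext p
  rw [hσ, hasm, hasm]

end Assemble

/-! ### The tube action splits over slabs -/

section Action

variable {G : Type*} [Group G] {T : ℕ} {S : Type*} [Fintype S] {n : ℕ} [NeZero T]
  (ρ : G →* Matrix (Fin n) (Fin n) ℂ) (β : ℝ)
  (shS : S → Fin 3 → S) (sh : ZMod T × S → Fin 4 → ZMod T × S)
  (hsh0 : ∀ t s, sh (t, s) 0 = (t + 1, s)) (hshs : ∀ t s (j : Fin 3), sh (t, s) j.succ = (t, shS s j))
  (ins : ZMod T × S → Fin 4 → Fin 4 → ℝ) (insS : S → Fin 4 → Fin 4 → ℝ)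
  (hins : ∀ t s μ κ, ins (t, s) μ κ = insS s μ κ)
  (pl : ((ZMod T × S) × Fin 4 → G) → ZMod T × S → Fin 4 → Fin 4 → G)
  (hpl : ∀ U x μ κ, pl U x μ κ = U (x, μ) * U (sh x μ, κ) * (U (sh x κ, μ))⁻¹ * (U (x, κ))⁻¹)
  (act : ((ZMod T × S) × Fin 4 → G) → ℝ)
  (asm : (ZMod T → S × Fin 3 → G) × (ZMod T → S → G) → (ZMod T × S) × Fin 4 → G)
  (hasm : ∀ p e, asm p e = (Fin.cons (p.2 e.1.1 e.1.2) (fun i : Fin 3 => p.1 e.1.1 (e.1.2, i)) : Fin 4 → G) e.2)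
  (Ssp : (S × Fin 3 → G) → ℝ)
  (hSsp : ∀ a, Ssp a = β * ∑ s : S, ∑ i : Fin 3, ∑ j : Fin 3, if i < j then insS s i.succ j.succ *
    (ρ (a (s, i) * a (shS s i, j) * (a (shS s j, i))⁻¹ * (a (s, j))⁻¹)).trace.re else 0)
  (Stm : (S × Fin 3 → G) → (S → G) → (S × Fin 3 → G) → ℝ)
  (hStm : ∀ a e b, Stm a e b = β * ∑ s : S, ∑ j : Fin 3, insS s 0 j.succ *
    (ρ (e s * b (s, j) * (e (shS s j))⁻¹ * (a (s, j))⁻¹)).trace.re)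

include hsh0 hshs hins hpl hasm hSsp hStm in
/-- **The tube action splits over slabs**: the action of an assembled configuration is the sum over time of the
spatial plaquette energy `Ssp` of each slice and the temporal plaquette energy `Stm` between consecutive slices (the
temporal plaquette at `(t, s)` in the plane `(0, j+1)` is `E t s · V (t+1) (s, j) · (E t (s + ĵ))⁻¹ · (V t (s, j))⁻¹`).
[cite: MontvayMunster1994, §3.2.6 (3.139)–(3.142)] -/
theorem act_asm
    (hact : ∀ U, act U = β * ∑ x, ∑ q : {q : Fin 4 × Fin 4 // q.1 < q.2},
      ins x q.1.1 q.1.2 * (ρ (pl U x q.1.1 q.1.2)).trace.re)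
    (p : (ZMod T → S × Fin 3 → G) × (ZMod T → S → G)) :
    act (asm p) = ∑ t, (Ssp (p.1 t) + Stm (p.1 t) (p.2 t) (p.1 (t + 1))) := by
  have hsite : ∀ (t : ZMod T) (s : S),
      ∑ q : {q : Fin 4 × Fin 4 // q.1 < q.2}, ins (t, s) q.1.1 q.1.2 * (ρ (pl (asm p) (t, s) q.1.1 q.1.2)).trace.re =
        (∑ j : Fin 3, insS s 0 j.succ *
            (ρ (p.2 t s * p.1 (t + 1) (s, j) * (p.2 t (shS s j))⁻¹ * (p.1 t (s, j))⁻¹)).trace.re) +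
          ∑ i : Fin 3, ∑ j : Fin 3, if i < j then insS s i.succ j.succ *
            (ρ (p.1 t (s, i) * p.1 t (shS s i, j) * (p.1 t (shS s j, i))⁻¹ * (p.1 t (s, j))⁻¹)).trace.re else 0 := by
    intro t s
    rw [sum_subtype_lt_eq (fun μ κ => ins (t, s) μ κ * (ρ (pl (asm p) (t, s) μ κ)).trace.re), sum_sum_ite_lt_succ]
    simp only [hpl, hins, hsh0, hshs, asm_apply_zero asm hasm, asm_apply_succ asm hasm]
  rw [hact, Fintype.sum_prod_type, Finset.mul_sum]
  refine Finset.sum_congr rfl fun t _ => ?_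
  rw [hSsp, hStm, Finset.mul_sum, Finset.mul_sum, Finset.mul_sum, ← Finset.sum_add_distrib]
  refine Finset.sum_congr rfl fun s _ => ?_
  rw [hsite]
  ring

variable [TopologicalSpace G] [IsTopologicalGroup G]

include hpl in
/-- **The tube action is continuous** (continuous `ρ`). [folklore] -/
theorem continuous_act (hρ : Continuous ρ)
    (hact : ∀ U, act U = β * ∑ x, ∑ q : {q : Fin 4 × Fin 4 // q.1 < q.2},
      ins x q.1.1 q.1.2 * (ρ (pl U x q.1.1 q.1.2)).trace.re) : Continuous act := by
  have h : act = fun U => β * ∑ x, ∑ q : {q : Fin 4 × Fin 4 // q.1 < q.2},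
      ins x q.1.1 q.1.2 * (ρ (pl U x q.1.1 q.1.2)).trace.re := funext hact
  have htr : Continuous fun g : G => (ρ g).trace.re := Complex.continuous_re.comp (Continuous.matrix_trace hρ)
  have hc : ∀ e : (ZMod T × S) × Fin 4, Continuous fun U : (ZMod T × S) × Fin 4 → G => U e := fun e => continuous_apply e
  rw [h]
  refine continuous_const.mul (continuous_finsetSum _ fun x _ => continuous_finsetSum _ fun q _ =>
    continuous_const.mul (htr.comp ?_))
  simp only [hpl]
  exact (((hc _).mul (hc _)).mul (hc _).inv).mul (hc _).inv

include hpl in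
/-- The tube action is bounded (continuity on the compact configuration space). [folklore] -/
theorem exists_abs_act_le [CompactSpace G] (hρ : Continuous ρ)
    (hact : ∀ U, act U = β * ∑ x, ∑ q : {q : Fin 4 × Fin 4 // q.1 < q.2},
      ins x q.1.1 q.1.2 * (ρ (pl U x q.1.1 q.1.2)).trace.re) : ∃ C : ℝ, ∀ U, |act U| ≤ C := by
  obtain ⟨C, hC⟩ := isCompact_univ.exists_bound_of_continuousOn
    (continuous_act ρ β sh ins pl hpl act hρ hact).continuousOn
  exact ⟨C, fun U => (Real.norm_eq_abs _).symm.trans_le (hC U (Set.mem_univ _))⟩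

include hSsp in
/-- **The slice energy is continuous** (continuous `ρ`). [folklore] -/
theorem continuous_Ssp (hρ : Continuous ρ) : Continuous Ssp := by
  have h : Ssp = fun a => β * ∑ s : S, ∑ i : Fin 3, ∑ j : Fin 3, if i < j then insS s i.succ j.succ *
      (ρ (a (s, i) * a (shS s i, j) * (a (shS s j, i))⁻¹ * (a (s, j))⁻¹)).trace.re else 0 := funext hSsp
  have htr : Continuous fun g : G => (ρ g).trace.re := Complex.continuous_re.comp (Continuous.matrix_trace hρ)
  have hc : ∀ l : S × Fin 3, Continuous fun a : S × Fin 3 → G => a l := fun l => continuous_apply l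
  rw [h]
  refine continuous_const.mul (continuous_finsetSum _ fun s _ => continuous_finsetSum _ fun i _ =>
    continuous_finsetSum _ fun j _ => ?_)
  by_cases hij : i < j
  · simp only [hij, if_true]
    exact continuous_const.mul (htr.comp ((((hc _).mul (hc _)).mul (hc _).inv).mul (hc _).inv))
  · simp only [hij, if_false]
    exact continuous_const

include hStm in
/-- **The layer energy is jointly continuous** in (slice, layer, slice) (continuous `ρ`). [folklore] -/
theorem continuous_Stm (hρ : Continuous ρ) :
    Continuous fun z : (S × Fin 3 → G) × (S → G) × (S × Fin 3 → G) => Stm z.1 z.2.1 z.2.2 := by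
  have htr : Continuous fun g : G => (ρ g).trace.re := Complex.continuous_re.comp (Continuous.matrix_trace hρ)
  have ha : ∀ l : S × Fin 3, Continuous fun z : (S × Fin 3 → G) × (S → G) × (S × Fin 3 → G) => z.1 l :=
    fun l => (continuous_apply l).comp continuous_fst
  have he : ∀ y : S, Continuous fun z : (S × Fin 3 → G) × (S → G) × (S × Fin 3 → G) => z.2.1 y :=
    fun y => (continuous_apply y).comp (continuous_fst.comp continuous_snd)
  have hb : ∀ l : S × Fin 3, Continuous fun z : (S × Fin 3 → G) × (S → G) × (S × Fin 3 → G) => z.2.2 l :=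
    fun l => (continuous_apply l).comp (continuous_snd.comp continuous_snd)
  simp only [hStm]
  refine continuous_const.mul (continuous_finsetSum _ fun s _ => continuous_finsetSum _ fun j _ =>
    continuous_const.mul (htr.comp ?_))
  exact (((he _).mul (hb _)).mul (he _).inv).mul (ha _).inv

include hSsp in
/-- The slice energy is bounded. [folklore] -/
theorem exists_abs_Ssp_le [CompactSpace G] (hρ : Continuous ρ) : ∃ B : ℝ, ∀ a, |Ssp a| ≤ B := by
  obtain ⟨B, hB⟩ := isCompact_univ.exists_bound_of_continuousOn
    (continuous_Ssp ρ β shS insS Ssp hSsp hρ).continuousOn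
  exact ⟨B, fun a => (Real.norm_eq_abs _).symm.trans_le (hB a (Set.mem_univ _))⟩

include hStm in
/-- The layer energy is bounded. [folklore] -/
theorem exists_abs_Stm_le [CompactSpace G] (hρ : Continuous ρ) : ∃ B : ℝ, ∀ a e b, |Stm a e b| ≤ B := by
  obtain ⟨B, hB⟩ := isCompact_univ.exists_bound_of_continuousOn
    (continuous_Stm ρ β shS insS Stm hStm hρ).continuousOn
  exact ⟨B, fun a e b => (Real.norm_eq_abs _).symm.trans_le (hB (a, e, b) (Set.mem_univ _))⟩

end Action

end Literature.MathematicalPhysics.QuantumFieldTheory.FreeTube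

end
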